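import Summits.BirchSwinnertonDyer.Rank1Residual.X2.ResidualLineCharacters
import Literature.NumberTheory.EllipticCurves.Rank1Residual.GVParityTransferProofs
import HarnessLib

/-!
# Class X2 (odd Eisenstein prime): the characters of an UNRAMIFIED-ODD rational line `Φ₀` and of
# its quotient `E[p]/Φ₀` — parity and ramification in Greenberg–Vatsal's SECOND case
# (cell `b2b-bsdres`, unit `b2b-bsdres-eisenstein-p2`, gen 22; companion of gen 21's
# `ResidualLineCharacters.lean`, which treats the first case `Φ₀` ramified-even)

HONEST FRAMING (run/shared/lean/b2b/bsd-rank1-residual/, verbatim in every file): the goal of the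
cell is to DELETE the COMBINATION-SHAPED residual classes of the Birch–Swinnerton-Dyer formula for
ALL analytic-rank `≤ 1` elliptic curves over `ℚ` — "full BSD formula for every rank `≤ 1` curve in
class `C`" assembled STRICTLY from published theorems — so that the rank-`≤ 1` remainder becomes
exactly the CONSTRUCTION-SHAPED classes, which are TYPED (missing-input `Prop`s), NOT attempted.
This is not "finishing BSD". Research route; NO CLAIM BEYOND STATED CLASSES; nothing here changes a
label. Theorems only (no definition, no named fact, nothing asserted).

## What this file proves

Greenberg, LNM 1716, proof of Prop. 5.10 (PDF p. 148), second case: "if `A` is infinite, then `Φ`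
must be odd and hence unramified. Thus, `Φ ∩ C_π̄ = 0`"; Greenberg–Vatsal 2000 p. 28: "`φψ = ω` …
In the second case … `Ψ` is ramified and even". For `E/ℚ` elliptic, `p` prime, a rational line
`Φ₀ ≤ E[p]` (`IsRationalLine`) with its characters read on gen 16's transported line
`(lineSub Φ₀ hΦ).Sub` and quotient `(lineSub Φ₀ hΦ).Quot` (gen 21 `exists_character_sub/_quot`):

* `smul_sub_self_mem_of_lineOdd` — for an ODD line and `p` odd, every complex conjugation `c`
  satisfies `c • P − P ∈ Φ₀` for all `P ∈ E[p]` (the `c`-fixed Weil-pairing eigenvector spans a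
  complement of `Φ₀`); hence `smul_quot_eq_self_of_lineOdd` (`c` acts trivially on `E[p]/Φ₀`);
* `odd_of_lineOdd` (the character of `Φ₀` is ODD) and `even_of_lineOdd` (the character of
  `E[p]/Φ₀` is EVEN);
* `not_dvd_level_sub_of_lineUnramifiedAt` — for a line UNRAMIFIED at `p`, the conductor of the
  (primitive) character of `Φ₀` is prime to `p`;
* `inf_eq_bot_of_lineUnramifiedAt` — an unramified rational line meets Serre's inertia line `L` of
  the local structure (hL) trivially, and `dvd_level_quot_of_lineUnramifiedAt` — the character of
  `E[p]/Φ₀` is RAMIFIED at `p` (`p ∣ m`): otherwise inertia at `𝔓` would fix `Φ₀ ⊕ L = E[p]`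
  pointwise, contradicting the moving element of (hL) (Tate line at `p ‖ N`, reduction line at good
  ordinary `p`).

References: [GreenbergLNM1716] Prop. 5.10 (proof, PDF p. 148); [GreenbergVatsal2000] §2 p. 28;
[Washington1997] Ch. 3 (Dirichlet characters as Galois characters).
-/

set_option autoImplicit false

noncomputable section

open scoped Classical

open NumberField IsDedekindDomain Field Rat.HeightOneSpectrum WeierstrassCurve
  Literature.NumberTheory.GaloisRepresentations Literature.NumberTheory.EllipticCurves
  Literature.NumberTheory.EllipticCurves.Rank1Residual
  Summit.BirchSwinnertonDyer.Rank1Residual.X2.ResidualDevissageModules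
  Summit.BirchSwinnertonDyer.Rank1Residual.X2.ResidualDevissageLine
  Summit.BirchSwinnertonDyer.Rank1Residual.X2.PrimeOrderCharacters
  Summit.BirchSwinnertonDyer.Rank1Residual.X2.ResidualLineCharacters

namespace Summit.BirchSwinnertonDyer.Rank1Residual.X2.ResidualLineCharactersOdd

variable {W : WeierstrassCurve ℚ} [W.IsElliptic] {p : ℕ} [hp : Fact p.Prime]
  {Φ₀ : AddSubgroup (geomTorsion W (p : ℤ))} (hΦ : IsRationalLine W p Φ₀)

/-! ## §1. Complex conjugation acts trivially on `E[p]/Φ₀` for an ODD line -/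

include hΦ in
/-- **`c • P − P ∈ Φ₀` for every `P ∈ E[p]`**, `c` a complex conjugation, `Φ₀` an ODD rational
line, `p` odd: the `c`-FIXED eigenvector `P₊ ≠ 0` (tree `exists_fixed_and_antifixed_of_isComplexConjugation`,
Weil pairing) is not in `Φ₀` (there `c` acts as `−1` and `2P₊ = 0` would force `P₊ = 0`), so
`E[p] = Φ₀ ⊕ ℤP₊` and `c` acts as `+1` on `E[p]/Φ₀`. GV p. 28: "`φψ = ω`" (the quotient character
of an odd line is even). [cite: GreenbergVatsal2000, §2 p. 28] -/
theorem smul_sub_self_mem_of_lineOdd (hp2 : p ≠ 2) (hodd : LineOdd W p Φ₀)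
    {c : absoluteGaloisGroup ℚ} (hc : IsComplexConjugation (Rat.castHom ℝ) c)
    (P : geomTorsion W (p : ℤ)) : c • P - P ∈ Φ₀ := by
  have hpr : p.Prime := Fact.out
  have hoddp : Odd p := hpr.odd_of_ne_two hp2
  obtain ⟨⟨Q, hQ0, hcQ⟩, -⟩ := exists_fixed_and_antifixed_of_isComplexConjugation W hp2 c hc
  -- `Q ∉ Φ₀`
  have hQΦ : Q ∉ Φ₀ := fun hQ ↦ hQ0 <| by
    refine eq_zero_of_two_nsmul_eq_zero hoddp Q (nsmul_eq_zero_of_mem_geomTorsion Q) ?_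
    rw [two_nsmul]
    nth_rewrite 1 [← hcQ]
    rw [hodd c hc Q hQ, neg_add_cancel]
  -- `ℤQ` has order `p` and `Φ₀ ⊔ ℤQ = E[p]`
  have hQord : addOrderOf Q = p := addOrderOf_eq_prime (nsmul_eq_zero_of_mem_geomTorsion Q) hQ0
  have hZQ : Nat.card (AddSubgroup.zmultiples Q) = p := by rw [Nat.card_zmultiples, hQord]
  have hne : Φ₀ ≠ AddSubgroup.zmultiples Q := fun h ↦
    hQΦ (h ▸ AddSubgroup.mem_zmultiples Q)
  have htop : Φ₀ ⊔ AddSubgroup.zmultiples Q = ⊤ :=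
    sup_eq_top_of_ne (W.natCard_geomTorsion_eq_sq (Nat.cast_ne_zero.2 hpr.ne_zero)) hΦ.1 hZQ hne
  have hP : P ∈ Φ₀ ⊔ AddSubgroup.zmultiples Q := htop ▸ AddSubgroup.mem_top P
  obtain ⟨y, hy, z, hz, rfl⟩ := AddSubgroup.mem_sup.mp hP
  obtain ⟨k, rfl⟩ := AddSubgroup.mem_zmultiples_iff.mp hz
  have hcz : c • (k • Q) = k • Q := by
    change DistribSMul.toAddMonoidHom (geomTorsion W (p : ℤ)) c (k • Q) = _
    rw [map_zsmul, DistribSMul.toAddMonoidHom_apply, hcQ]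
  rw [smul_add, hodd c hc y hy, hcz]
  have : -y + k • Q - (y + k • Q) = -(y + y) := by abel
  rw [this]
  exact Φ₀.neg_mem (Φ₀.add_mem hy hy)

/-- **Complex conjugation acts trivially on `E[p]/Φ₀`** (`Φ₀` odd, `p` odd).
[cite: GreenbergVatsal2000, §2 p. 28] -/
theorem smul_quot_eq_self_of_lineOdd (hp2 : p ≠ 2) (hodd : LineOdd W p Φ₀)
    {c : absoluteGaloisGroup ℚ} (hc : IsComplexConjugation (Rat.castHom ℝ) c)
    (y : (lineSub Φ₀ hΦ).Quot) : c • y = y := by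
  refine ((lineSub Φ₀ hΦ).forall_smul_quot_eq_self_iff c).2 (fun m ↦ ?_) y
  obtain ⟨P, rfl⟩ := (torsionToPrimary_bijective W p).2 m
  rw [← torsionToPrimary_smul, ← map_sub, torsionToPrimary_mem_lineSub_iff]
  exact smul_sub_self_mem_of_lineOdd hΦ hp2 hodd hc P

omit [W.IsElliptic] in
/-- Complex conjugation acts as `−1` on the transported line of an ODD `Φ₀`. [folklore] -/
theorem smul_sub_eq_neg_of_lineOdd (hodd : LineOdd W p Φ₀)
    {c : absoluteGaloisGroup ℚ} (hc : IsComplexConjugation (Rat.castHom ℝ) c)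
    (x : (lineSub Φ₀ hΦ).Sub) : c • x = -x := by
  apply (lineSub Φ₀ hΦ).incl_injective
  obtain ⟨P, hP, hPx⟩ : (lineSub Φ₀ hΦ).incl x ∈ Φ₀.map (torsionToPrimary W p) := x.2
  rw [StableSubgroup.incl_smul, map_neg, ← hPx, ← torsionToPrimary_smul, hodd c hc P hP, map_neg]

/-! ## §2. Parity of the two characters for an ODD line -/

include hΦ in
omit [W.IsElliptic] in
/-- **The character of an ODD line `Φ₀` is odd** (complex conjugation acts as `−1` on `Φ₀`, and
`χ_d(c) = −1`). [cite: GreenbergVatsal2000, §2 p. 28] -/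
theorem odd_of_lineOdd (hodd : LineOdd W p Φ₀) {d : ℕ} [NeZero d]
    {ψ : DirichletCharacter (ZMod p) d}
    (hψ : ∀ (σ : absoluteGaloisGroup ℚ) (x : (lineSub Φ₀ hΦ).Sub),
      σ • x = (ψ ((modNCyclotomicCharacter ℚ d σ : (ZMod d)ˣ) : ZMod d)).val • x) :
    ψ.Odd := by
  obtain ⟨c, hc⟩ := exists_isComplexConjugation (K := ℚ) (Rat.castHom ℝ)
  have hχ : ∀ (σ : absoluteGaloisGroup ℚ) (x : (lineSub Φ₀ hΦ).Sub),
      σ • x = ((ψ.toUnitHom.comp (modNCyclotomicCharacter ℚ d) σ : (ZMod p)ˣ) : ZMod p).val • x :=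
    fun σ x ↦ by rw [coe_toUnitHom_comp, hψ]
  have h1 := character_eq_intCast_of_forall_smul_eq (natCard_sub_eq hΦ) hχ (σ := c) (a := -1)
    (fun x ↦ by rw [neg_one_zsmul]; exact smul_sub_eq_neg_of_lineOdd hΦ hodd hc x)
  rw [coe_toUnitHom_comp, modNCyclotomicCharacter_of_isComplexConjugation hc, Int.cast_neg,
    Int.cast_one] at h1
  exact h1

include hΦ in
/-- **The character of `E[p]/Φ₀` is even for an ODD line `Φ₀`** (`p` odd): complex conjugation acts
trivially on the quotient (`smul_quot_eq_self_of_lineOdd`). GV p. 28: in the second case "`Ψ` is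
ramified and even". [cite: GreenbergVatsal2000, §2 p. 28] -/
theorem even_of_lineOdd (hp2 : p ≠ 2) (hodd : LineOdd W p Φ₀) {m : ℕ} [NeZero m]
    {φ : DirichletCharacter (ZMod p) m}
    (hφ : ∀ (σ : absoluteGaloisGroup ℚ) (y : (lineSub Φ₀ hΦ).Quot),
      σ • y = (φ ((modNCyclotomicCharacter ℚ m σ : (ZMod m)ˣ) : ZMod m)).val • y) :
    φ.Even := by
  obtain ⟨c, hc⟩ := exists_isComplexConjugation (K := ℚ) (Rat.castHom ℝ)
  have hχ : ∀ (σ : absoluteGaloisGroup ℚ) (y : (lineSub Φ₀ hΦ).Quot),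
      σ • y = ((φ.toUnitHom.comp (modNCyclotomicCharacter ℚ m) σ : (ZMod p)ˣ) : ZMod p).val • y :=
    fun σ y ↦ by rw [coe_toUnitHom_comp, hφ]
  have h1 := character_eq_intCast_of_forall_smul_eq (natCard_quot_eq hΦ) hχ (σ := c) (a := 1)
    (fun y ↦ by rw [one_zsmul]; exact smul_quot_eq_self_of_lineOdd hΦ hp2 hodd hc y)
  rw [coe_toUnitHom_comp, modNCyclotomicCharacter_of_isComplexConjugation hc, Int.cast_one] at h1
  exact h1

/-! ## §3. Ramification of the two characters for a line UNRAMIFIED at `p` -/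

include hΦ in
omit [W.IsElliptic] in
/-- **The character of a line `Φ₀` UNRAMIFIED at `p` has conductor prime to `p`**: every inertia
group above `p` fixes `Φ₀` pointwise, so `ψ(χ_d(τ)) = 1` on `I_𝔓` and the conductor criterion
(`not_dvd_level_of_isPrimitive_of_forall_mem_inertia`) applies. Greenberg (PDF p. 148): "`Φ` must
be odd and hence unramified". [cite: GreenbergLNM1716, Prop. 5.10 (proof, PDF p. 148)] -/
theorem not_dvd_level_sub_of_lineUnramifiedAt (hunr : LineUnramifiedAt W p Φ₀) {d : ℕ} [NeZero d]
    {ψ : DirichletCharacter (ZMod p) d} (hψprim : ψ.IsPrimitive)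
    (hψ : ∀ (σ : absoluteGaloisGroup ℚ) (x : (lineSub Φ₀ hΦ).Sub),
      σ • x = (ψ ((modNCyclotomicCharacter ℚ d σ : (ZMod d)ˣ) : ZMod d)).val • x) :
    ¬ p ∣ d := by
  have hpr : p.Prime := hp.out
  obtain ⟨v, hv⟩ :=
    Literature.NumberTheory.NumberFields.RingOfIntegers.exists_heightOneSpectrum_natCast_mem ℚ hpr
  have hχ : ∀ (σ : absoluteGaloisGroup ℚ) (x : (lineSub Φ₀ hΦ).Sub),
      σ • x = ((ψ.toUnitHom.comp (modNCyclotomicCharacter ℚ d) σ : (ZMod p)ˣ) : ZMod p).val • x :=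
    fun σ x ↦ by rw [coe_toUnitHom_comp, hψ]
  refine not_dvd_level_of_isPrimitive_of_forall_mem_inertia hψprim hpr hv
    (adicCompletionPrime_mem_primesAbove ℚ v) fun τ hτ ↦ ?_
  have h1 := character_eq_intCast_of_forall_smul_eq (natCard_sub_eq hΦ) hχ (σ := τ) (a := 1)
    (fun x ↦ by
      rw [one_zsmul]
      exact smul_sub_eq_self_of_forall_mem hΦ
        (hunr v hv (adicCompletionPrime ℚ v) (adicCompletionPrime_mem_primesAbove ℚ v) τ hτ) x)
  rw [coe_toUnitHom_comp, Int.cast_one] at h1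
  exact h1

include hΦ in
omit [W.IsElliptic] in
/-- **An UNRAMIFIED rational line meets Serre's inertia line trivially**: if `L ≤ E[p]` has order
`p`, `(σ − 1)E[p] ⊆ L` for `σ ∈ I_𝔓` and some `σ ∈ I_𝔓` moves a point of `L` ((hL) at `𝔓 ∣ p`),
then `Φ₀ ⊓ L = ⊥` for every rational line `Φ₀` unramified at `p` (else `Φ₀ = L` would be fixed by
`I_𝔓`). Greenberg (PDF p. 148): "Thus, `Φ ∩ C_π̄ = 0`". [cite: GreenbergLNM1716, Prop. 5.10 (proof, PDF p. 148)] -/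
theorem inf_eq_bot_of_lineUnramifiedAt (hunr : LineUnramifiedAt W p Φ₀)
    {v : HeightOneSpectrum (𝓞 ℚ)} (hv : (p : 𝓞 ℚ) ∈ v.asIdeal)
    {𝔓 : Ideal (absIntegers (𝓞 ℚ) ℚ)} (h𝔓 : 𝔓 ∈ v.primesAbove)
    {L : AddSubgroup (geomTorsion W (p : ℤ))} (hLcard : Nat.card L = p)
    (hmove : ∃ σ ∈ 𝔓.inertia (absoluteGaloisGroup ℚ), ∃ P ∈ L, σ • P ≠ P) :
    Φ₀ ⊓ L = ⊥ := by
  rcases line_eq_or_inf_eq_bot hΦ.1 hLcard with h | h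
  · exfalso
    obtain ⟨σ, hσ, P, hP, hne⟩ := hmove
    exact hne (hunr v hv 𝔓 h𝔓 σ hσ P (h ▸ hP))
  · exact h

include hΦ in
omit [W.IsElliptic] in
/-- **The character of `E[p]/Φ₀` is RAMIFIED at `p` (`p ∣ m`) for a line UNRAMIFIED at `p`**, given
the local structure (hL) at a prime `𝔓 ∣ p` (Tate line at `p ‖ N`, reduction line at good ordinary
`p`): if `p ∤ m` then `χ_m` is trivial on `I_𝔓`, so `I_𝔓` acts trivially on `E[p]/Φ₀`, i.e.
`(τ − 1)E[p] ⊆ Φ₀ ∩ L = 0` — contradicting the moving element of (hL). GV p. 28: in the second case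
"`Ψ` is ramified". [cite: GreenbergVatsal2000, §2 p. 28] [cite: GreenbergLNM1716, Prop. 5.10 (proof, PDF p. 148)] -/
theorem dvd_level_quot_of_lineUnramifiedAt
    (hline : ∃ (v : HeightOneSpectrum (𝓞 ℚ)), (p : 𝓞 ℚ) ∈ v.asIdeal ∧ ∃ 𝔓 ∈ v.primesAbove,
      ∃ L : AddSubgroup (geomTorsion W (p : ℤ)), Nat.card L = p ∧
        (∀ σ ∈ 𝔓.inertia (absoluteGaloisGroup ℚ), ∀ P : geomTorsion W (p : ℤ), σ • P - P ∈ L) ∧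
        (∃ σ ∈ 𝔓.inertia (absoluteGaloisGroup ℚ), ∃ P ∈ L, σ • P ≠ P))
    (hunr : LineUnramifiedAt W p Φ₀) {m : ℕ} [NeZero m] {φ : DirichletCharacter (ZMod p) m}
    (hφ0 : ∀ (σ : absoluteGaloisGroup ℚ) (P : geomTorsion W (p : ℤ)),
      σ • P - (φ ((modNCyclotomicCharacter ℚ m σ : (ZMod m)ˣ) : ZMod m)).val • P ∈ Φ₀) :
    p ∣ m := by
  have hpr : p.Prime := hp.out
  obtain ⟨v, hv, 𝔓, h𝔓, L, hLcard, hLsub, hmove⟩ := hline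
  have hbot : Φ₀ ⊓ L = ⊥ := inf_eq_bot_of_lineUnramifiedAt hΦ hunr hv h𝔓 hLcard hmove
  obtain ⟨σ, hσI, P, hPL, hne⟩ := hmove
  by_contra hpm
  apply hne
  have hpv : ((primesEquiv v : Nat.Primes) : ℕ) = p := natGenerator_eq_of_natCast_mem_asIdeal hpr hv
  have hN : (m : absIntegers (𝓞 ℚ) ℚ) ∉ 𝔓 :=
    Rat.natCast_not_mem_of_mem_primesAbove_of_not_dvd h𝔓 (by rw [hpv]; exact hpm)
  haveI := h𝔓.1
  have h1 : modNCyclotomicCharacter ℚ m σ = 1 := modNCyclotomicCharacter_eq_one_of_mem_inertia hN hσI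
  -- `σ • P - P ∈ Φ₀ ⊓ L = ⊥`
  have h2 := hφ0 σ P
  rw [h1, Units.val_one, map_one, ZMod.val_one'' hpr.ne_one, one_nsmul] at h2
  have h3 : σ • P - P ∈ Φ₀ ⊓ L := AddSubgroup.mem_inf.2 ⟨h2, hLsub σ hσI P⟩
  rw [hbot, AddSubgroup.mem_bot, sub_eq_zero] at h3
  exact h3

end Summit.BirchSwinnertonDyer.Rank1Residual.X2.ResidualLineCharactersOdd

end
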